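import Summits.HodgeConjecture.HodgeConjecture.Theorems.Ring2AbelianAllSpreadFloorMiddle
import Summits.HodgeConjecture.HodgeConjecture.Theorems.Ring2BindersAbelianSchemeVHCMiddleLift
import Literature.AlgebraicGeometry.HodgeTheory.WeilClassesSixfoldsProofs
import Literature.AlgebraicGeometry.HodgeTheory.HodgeGenericQbarDescentFiniteMonodromyInputs
import Literature.AlgebraicGeometry.Milne1999.CodesHCOfCMHodgeHypothesis
import HarnessLib

/-!
# Ring 2 · AbelianAll · SPREADING axis, part XXV — the floor class located EXACTLY, codimension by codimension:
# modulo Deligne's printed fact, `F_CM ⟺ ∀ p, (HC_CM⁽ᵖ⁾ → HC_AV⁽ᵖ⁾)` and `F_CM^mid ⟺ ∀ m ≥ 2, (HC_CM⁽ᵐ⁾ → HC_AVmid⁽ᵐ⁾)`;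
# the product-datum engine `IsCMAnchoredDatumFor.prod` is fact-free

research route, not a corollary; conditional on HC_CM plus one named minimal statement.
(Cell line: research route conditional on HC_CM; not a corollary; Q11.4-sentence-2 already refuted in dim ≥ 3.)

Seat `pub-hodge-ring2-ab-spread-1` (SPREADING), generation 28. Nothing in this file is a case of the Hodge conjecture,
and NO new node / def / abbrev is minted (lesson F-ab-103): the codimension-graded shapes below are DISPLAY-ONLY local
notations for unfoldings of the EXISTING constants `HodgeAbelianVarieties` (`HC_AV`), `CMAbelianHodge` (`HC_CM`):

* `HC_AV⁽p⁾`  : every rational `(p,p)`-class on every complex abelian variety is algebraic (codimension `p` fixed);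
* `HC_CM⁽p⁾`  : the same on every abelian variety OF CM TYPE (`Milne1999.IsOfCMType`);
* `HC_AVmid⁽m⁾`: the same in codimension `m` on abelian varieties of dimension `2m`.

§1 records `HC_AV ↔ ∀ p, HC_AV⁽p⁾`, `HC_CM ↔ ∀ p, HC_CM⁽p⁾`, `HC_AV ↔ ∀ m ≥ 2, HC_AVmid⁽m⁾` (part XV), so that the served item
reads `CMToAbelian ↔ ((∀ p, HC_CM⁽p⁾) → ∀ p, HC_AV⁽p⁾)` (§5).

## What is proved

* §2 (NO fact) `F_CM → ∀ p, (HC_CM⁽p⁾ → HC_AV⁽p⁾)` and `F_CM^mid → ∀ m ≥ 2, (HC_CM⁽m⁾ → HC_AVmid⁽m⁾)`: an anchored CM failure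
  in codimension `p` is a failure of `HC_CM` IN THE SAME CODIMENSION (chart transport `IsoTransport`), and
  `(∀ p, HC_CM⁽p⁾ → HC_AV⁽p⁾) → CMToAbelian`.
* §3 (NO fact) the PRODUCT-DATUM ENGINE `IsCMAnchoredDatumFor.prod`: if `(f : 𝒳 ⟶ S, n, s, W)` is a CM-anchored datum for
  `(A, p, c)` with `p ≠ 0`, and `B` is a CM abelian variety carrying a rational `(p,p)`-class `b`, then
  `(fst 𝒳 B.X ≫ f, n + dim B, s, fst^* W + snd^* b)` is again a CM-anchored datum for `(A, p, c)` (anchor `A₁ × B`,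
  homomorphism `(g, 0) : A ⟶ A₁ × B`, the `0`-component killing `b` in degree `2p ≠ 0`), its CM locus contains that of `f`
  (`IsOfCMType.prod`), and at EVERY fibre algebraicity of the restricted class forces `b` algebraic (pull back along the
  slice `(0, 𝟙) : B ⟶ 𝒳_t × B`, `map_mem_algebraicClasses_of_abelianVariety`). The family-side inputs are part b02's
  `Ring2.Binders.exists_fiberOver_fst_comp_iso / isSmoothProjectiveFamily_fst_comp / exists_abelianVariety_iso_fiberOver_fst_comp`.
* §4 (MOD `hF := Deligne1982.deligne1982_cmDenseMumfordTateFamilies`, displayed) the CONVERSES: given a Hodge failure `(A, p, c)`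
  and `∀ q, HC_CM⁽q⁾ → HC_AV⁽q⁾`, codimension `p` yields a CM failure `(B, b)` in codimension `p`; Deligne's family through
  `A` (part VII `exists_datum_of_isCMDenseMumfordTateFamilyFor`) times `B` is, by §3, an anchored datum whose class fails
  at every CM fibre — this is `F_CM`. Hence `F_CM ⟺ ∀ p, (HC_CM⁽p⁾ → HC_AV⁽p⁾)` and, binder for binder,
  `F_CM^mid ⟺ ∀ m ≥ 2, (HC_CM⁽m⁾ → HC_AVmid⁽m⁾)`, both mod `hF`. POINTWISE (`hodgeFailureSpreadsToCMFibreAt_iff_of_deligne1982`):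
  for a rational `(p,p)`-class `c` on `A`, `p ≠ 0`, the instance of `F_CM` at `(A, p, c)` holds iff
  (`c ∉ algebraicClasses A.X p ⟹ ¬ HC_CM⁽p⁾`) — the anchored datum carries no information about `(A, c)` beyond `p`.
* §5 the assembled reading `spreadFloor_codimension_reading_of_deligne1982`.

## Honest column

(a) This SHARPENS part VII §E(a) ("anchoring at a non-CM `A` is the content"): anchoring IS satisfiable for every Hodge
failure as soon as `HC_CM` fails in the SAME codimension (Deligne family × CM witness), so — mod `hF` — the excess of the
floor class `F_CM ≡ F_CM^prim ≡ F_CM^{prim,ev}` (part XXIII) over the served item `CMToAbelian ≡ (HC_CM → HC_AV)` is EXACTLY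
codimension matching: `∀ p (HC_CM⁽p⁾ → HC_AV⁽p⁾)` versus `(∀ p HC_CM⁽p⁾) → (∀ p HC_AV⁽p⁾)`. No implication between the graded
and the ungraded implication is claimed beyond graded → ungraded (§2); whether they differ is exactly whether a failure of
`HC_CM` could live only in codimensions where `HC_AV` holds — unknown, and not asserted either way.
(b) `F_CM^mid → F_CM` is still NOT claimed: mod `hF` it would read `(∀ m ≥ 2, HC_CM⁽m⁾ → HC_AVmid⁽m⁾) → ∀ p (HC_CM⁽p⁾ → HC_AV⁽p⁾)`,
and the middle-degree reduction of part XV changes the codimension, so the gradings do not align.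
(c) `p = 0` is excluded from the engine (`H⁰` sees the zero homomorphism); it is vacuous for failures (`algebraicClasses_zero`).
(d) Standing of the nodes is unchanged: every `… → HC_AV`-type closing still needs `HC_CM`; the census placement of this
reading (a label on existing nodes, not a node) is the LEAD's call; the pen mints nothing.
-/

noncomputable section

set_option linter.dupNamespace false

open CategoryTheory AlgebraicGeometry MonoidalCategory CartesianMonoidalCategory
open Literature.AlgebraicGeometry Literature.AlgebraicGeometry.Motives
open Literature.AlgebraicGeometry.HodgeTheory
open Literature.AlgebraicGeometry.Milne1999 (IsOfCMType)
open Literature.AlgebraicGeometry.Deligne1982 (deligne1982_cmDenseMumfordTateFamilies IsCMDenseMumfordTateFamilyFor)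

namespace Summit.HodgeConjecture.HodgeConjecture.Ring2.AbelianAll

open Summit.HodgeConjecture.HodgeConjecture
open Summit.HodgeConjecture.HodgeConjecture.Theorems
open Summit.HodgeConjecture.HodgeConjecture.Theses
open Summit.HodgeConjecture.HodgeConjecture.Theses.RankFourFaces (CMAbelianHodge CMToAbelian)
open Summit.HodgeConjecture.HodgeConjecture.Theses.PadicSemiregularLift (HodgeAbelianVarieties)
open Summit.HodgeConjecture.HodgeConjecture.Ring2.Deform (cmLocus)
open Summit.HodgeConjecture.HodgeConjecture.Ring2.Binders (exists_fiberOver_fst_comp_iso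
  isSmoothProjectiveFamily_fst_comp exists_abelianVariety_iso_fiberOver_fst_comp)
open Summit.HodgeConjecture.HodgeConjecture.Theorems.HodgeAbelianVarieties.Negative (iff_hodgeConjecture_restricted)

variable {𝒳 S : SchemeOver ℂ}

/-! ## §0 Display-only codimension-graded shapes (local notation; NO def, NO abbrev, nothing enters the census) -/

/-- `HC_AV⁽p⁾` — DISPLAY ONLY: the Hodge conjecture for complex abelian varieties in codimension `p`. -/
local notation3 (prettyPrint := false) "HC_AV⁽" p "⁾" =>
  ∀ (A : AbelianVariety ℂ) (c : complexBetti A.X (2 * p)), IsRationalClass c →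
    IsOfHodgeType A.dim A.X (2 * p) p p c → c ∈ algebraicClasses A.X p

/-- `HC_CM⁽p⁾` — DISPLAY ONLY: the Hodge conjecture for CM abelian varieties in codimension `p`. -/
local notation3 (prettyPrint := false) "HC_CM⁽" p "⁾" =>
  ∀ (A : AbelianVariety ℂ), IsOfCMType A → ∀ (c : complexBetti A.X (2 * p)), IsRationalClass c →
    IsOfHodgeType A.dim A.X (2 * p) p p c → c ∈ algebraicClasses A.X p

/-- `HC_AVmid⁽m⁾` — DISPLAY ONLY: the Hodge conjecture in the middle codimension `m` on abelian varieties of dimension `2m`. -/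
local notation3 (prettyPrint := false) "HC_AVmid⁽" m "⁾" =>
  ∀ (A : AbelianVariety ℂ), A.dim = 2 * m → ∀ (c : complexBetti A.X (2 * m)), IsRationalClass c →
    IsOfHodgeType A.dim A.X (2 * m) m m c → c ∈ algebraicClasses A.X m

/-! ## §1 The two constants and the middle-degree reduction, read codimension by codimension (bookkeeping) -/

/-- `HC_AV ↔ ∀ p, HC_AV⁽p⁾` (`hodgeConjectureFor_iff_of_isSmoothProjective`). [folklore] -/
theorem HC_AV_iff_forall_codim : HodgeAbelianVarieties ↔ ∀ p : ℕ, HC_AV⁽p⁾ := by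
  refine ⟨fun h p A c hc hpp ↦ (h A).2 p c hc hpp, fun h A ↦ ?_⟩
  exact (hodgeConjectureFor_iff_of_isSmoothProjective nonempty_hodgeModel_holds
    (AbelianVariety.isSmoothProjective_holds (A := A))).2 fun p c hc hpp ↦ h p A c hc hpp

/-- `HC_CM ↔ ∀ p, HC_CM⁽p⁾` (`CMAbelianHodge`'s CM clause is `Milne1999.IsOfCMType` verbatim). [folklore] -/
theorem HC_CM_iff_forall_codim : CMAbelianHodge ↔ ∀ p : ℕ, HC_CM⁽p⁾ := by
  refine ⟨fun h p A hA c hc hpp ↦ (h A AbelianVariety.isSmoothProjective_holds hA).2 p c hc hpp,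
    fun h A hAsp hA ↦ ?_⟩
  exact (hodgeConjectureFor_iff_of_isSmoothProjective nonempty_hodgeModel_holds hAsp).2
    fun p c hc hpp ↦ h p A hA c hc hpp

/-- `HC_AV ↔ ∀ m ≥ 2, HC_AVmid⁽m⁾` — part XV's middle-degree reduction `HC_AV_iff_forall_middleDegree`, rebracketed. [folklore] -/
theorem HC_AV_iff_forall_codim_middle : HodgeAbelianVarieties ↔ ∀ m : ℕ, 2 ≤ m → HC_AVmid⁽m⁾ := by
  refine ⟨fun h m _ A _ c hc hpp ↦ (h A).2 m c hc hpp, fun h ↦ HC_AV_iff_forall_middleDegree.2 ?_⟩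
  intro A m hm hA c hc hpp
  exact h m hm A hA c hc (by rw [hA]; exact hpp)

/-! ## §2 Fact-free: the anchored floor implies the codimension-graded implication -/

/-- **An anchored datum with a failing CM fibre IS a failure of `HC_CM` in the SAME codimension**, NO fact: transport
through the CM chart of the fibre (`IsoTransport`). Only the fibrewise clause of the datum is used. [folklore] -/
theorem not_codim_cm_of_isCMAnchoredDatumFor_of_not_mem {A : AbelianVariety ℂ} {p : ℕ} {c : complexBetti A.X (2 * p)}
    {f : 𝒳 ⟶ S} {n : ℕ} {s : ComplexPoints S} {W : complexBetti 𝒳 (2 * p)} (hd : IsCMAnchoredDatumFor A p c f n s W)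
    {s' : ComplexPoints S} (hs' : s' ∈ cmLocus f n)
    (hns' : complexBetti.map (fiberι f s') (2 * p) W ∉ algebraicClasses (fiberOver f s') p) : ¬ HC_CM⁽p⁾ := by
  obtain ⟨A₀, ⟨e₀⟩, hdim₀, hcm₀⟩ := hs'
  intro hCMp
  refine hns' ((mem_algebraicClasses_map_iff_of_iso e₀).1
    (hCMp A₀ hcm₀ _ ((isRationalClass_map_iff_of_iso e₀).2 (hd.2.1 s').1) ?_))
  rw [hdim₀]
  exact (isOfHodgeType_map_iff_of_iso e₀).2 (hd.2.1 s').2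

/-- **`F_CM ⟹ ∀ p, (HC_CM⁽p⁾ → HC_AV⁽p⁾)`**, NO fact. [folklore] -/
theorem forall_codim_cmToAbelian_of_hodgeFailureSpreadsToCMFibre (h : HodgeFailureSpreadsToCMFibre) (p : ℕ)
    (hCMp : HC_CM⁽p⁾) : HC_AV⁽p⁾ := by
  intro A c hc hpp
  by_contra hnc
  obtain ⟨n, 𝒳, S, f, s, W, hd, s', hs', hns'⟩ := h A AbelianVariety.isSmoothProjective_holds p c hc hpp hnc
  exact not_codim_cm_of_isCMAnchoredDatumFor_of_not_mem hd hs' hns' hCMp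

/-- **`F_CM^mid ⟹ ∀ m ≥ 2, (HC_CM⁽m⁾ → HC_AVmid⁽m⁾)`**, NO fact (binders of part XXIV). [folklore] -/
theorem forall_codim_middle_of_middleHodgeFailureSpreadsToCMFibre (h : MiddleHodgeFailureSpreadsToCMFibre) (m : ℕ)
    (hm : 2 ≤ m) (hCMm : HC_CM⁽m⁾) : HC_AVmid⁽m⁾ := by
  intro A hA c hc hpp
  by_contra hnc
  obtain ⟨n, 𝒳, S, f, s, W, hd, s', hs', hns'⟩ := h A AbelianVariety.isSmoothProjective_holds m hm hA c hc hpp hnc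
  exact not_codim_cm_of_isCMAnchoredDatumFor_of_not_mem hd hs' hns' hCMm

/-- `(∀ p, HC_CM⁽p⁾ → HC_AV⁽p⁾) ⟹ CMToAbelian` (the served item is the UNGRADED implication), NO fact. [folklore] -/
theorem cmToAbelian_of_forall_codim_cmToAbelian (h : ∀ p : ℕ, HC_CM⁽p⁾ → HC_AV⁽p⁾) : CMToAbelian :=
  fun hCM A _ ↦ (HC_AV_iff_forall_codim.2 fun p ↦ h p (HC_CM_iff_forall_codim.1 hCM p)) A

/-- ON-PATH: `HC_AV ⟹ ∀ p, (HC_CM⁽p⁾ → HC_AV⁽p⁾)`, NO fact. [folklore] -/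
theorem forall_codim_cmToAbelian_of_HC_AV (h : HodgeAbelianVarieties) (p : ℕ) : HC_CM⁽p⁾ → HC_AV⁽p⁾ :=
  fun _ ↦ HC_AV_iff_forall_codim.1 h p

/-! ## §3 Fact-free engine: the product of a CM-anchored datum with a CM abelian variety -/

/-- A chart `e' : X' ≅ 𝒳_t` of a fibre of `f` gives a chart `X' ⊗ B ≅ (𝒳 ⊗ B)_t` of the corresponding fibre of
`fst ≫ f`, compatible with the fibre inclusions (part b02 `exists_fiberOver_fst_comp_iso`). [folklore] -/
theorem exists_tensor_iso_fiberOver_fst_comp (f : 𝒳 ⟶ S) (B : SchemeOver ℂ) {X' : SchemeOver ℂ} (t : ComplexPoints S)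
    (e' : X' ≅ fiberOver f t) :
    ∃ ι : X' ⊗ B ≅ fiberOver (fst 𝒳 B ≫ f) t, ι.hom ≫ fiberι (fst 𝒳 B ≫ f) t = (e'.hom ≫ fiberι f t) ▷ B := by
  obtain ⟨e, he⟩ := exists_fiberOver_fst_comp_iso f B t
  exact ⟨whiskerRightIso e' B ≪≫ e, by rw [Iso.trans_hom, whiskerRightIso_hom, Category.assoc, he, comp_whiskerRight]⟩

/-- Pulling the class `fst^* W + snd^* b` back along `φ ▷ B` gives `fst^* (φ^* W) + snd^* b`. [folklore] -/
theorem complexBetti_map_whiskerRight_fst_add_snd {X' Y : SchemeOver ℂ} (φ : X' ⟶ Y) (B : SchemeOver ℂ) (k : ℕ)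
    (W : complexBetti Y k) (b : complexBetti B k) :
    complexBetti.map (φ ▷ B) k (complexBetti.map (fst Y B) k W + complexBetti.map (snd Y B) k b) =
      complexBetti.map (fst X' B) k (complexBetti.map φ k W) + complexBetti.map (snd X' B) k b := by
  rw [map_add, ← complexBetti.map_comp_apply', ← complexBetti.map_comp_apply', whiskerRight_fst, whiskerRight_snd,
    complexBetti.map_comp_apply']

/-- The underlying scheme map of `prodLift g h : T ⟶ A' × B`, as a morphism into `A'.X ⊗ B.X` with its two
components displayed (`AbelianVariety.prodLift_fst / prodLift_snd`). [folklore] -/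
theorem exists_prodLift_schemeHom {T A' B : AbelianVariety ℂ} (g : T ⟶ A') (h : T ⟶ B) :
    ∃ u : T.X ⟶ A'.X ⊗ B.X, (∃ G : T ⟶ A'.prod B, G.hom.hom.hom = u) ∧
      u ≫ fst A'.X B.X = g.hom.hom.hom ∧ u ≫ snd A'.X B.X = h.hom.hom.hom := by
  refine ⟨(AbelianVariety.prodLift g h).hom.hom.hom, ⟨_, rfl⟩, ?_, ?_⟩
  · change (AbelianVariety.prodLift g h ≫ AbelianVariety.fst A' B).hom.hom.hom = _
    rw [AbelianVariety.prodLift_fst]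
  · change (AbelianVariety.prodLift g h ≫ AbelianVariety.snd A' B).hom.hom.hom = _
    rw [AbelianVariety.prodLift_snd]

/-- The CM locus only grows under `f ↦ fst ≫ f` with a CM factor `B` (`Milne1999.IsOfCMType.prod`). [folklore] -/
theorem cmLocus_subset_cmLocus_fst_comp (f : 𝒳 ⟶ S) {n : ℕ} (B : AbelianVariety ℂ) (hB : IsOfCMType B) :
    cmLocus f n ⊆ cmLocus (fst 𝒳 B.X ≫ f) (n + B.dim) := by
  rintro t ⟨A₀, ⟨e₀⟩, hdim₀, hcm₀⟩
  obtain ⟨ι, -⟩ := exists_tensor_iso_fiberOver_fst_comp f B.X t e₀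
  exact ⟨A₀.prod B, ⟨ι⟩, by rw [AbelianVariety.dim_prod, hdim₀], hcm₀.prod hB⟩

/-- A CM-pointed abelian family times a CM abelian variety is a CM-pointed abelian family (part b02's family lemmas,
`isQuasiProjectiveOver_tensorObj_of_field`). [folklore] -/
theorem isCMPointedAbelianFamily_fst_comp {f : 𝒳 ⟶ S} {n : ℕ} (hfam : IsCMPointedAbelianFamily f n)
    (B : AbelianVariety ℂ) (hB : IsOfCMType B) : IsCMPointedAbelianFamily (fst 𝒳 B.X ≫ f) (n + B.dim) := by
  obtain ⟨hf, h𝒳, hS, hirr, hsm, hab, hne⟩ := hfam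
  have hBsp : IsSmoothProjective B.dim B.X := AbelianVariety.isSmoothProjective_holds
  exact ⟨isSmoothProjectiveFamily_fst_comp f hf hBsp,
    isQuasiProjectiveOver_tensorObj_of_field h𝒳 (IsQuasiProjectiveOver.of_isProjectiveOver hBsp.isProjectiveOver),
    hS, hirr, hsm, exists_abelianVariety_iso_fiberOver_fst_comp f hab B,
    hne.mono (cmLocus_subset_cmLocus_fst_comp f B hB)⟩

/-- **THE PRODUCT-DATUM ENGINE** (NO fact). For a CM-anchored datum `(f, n, s, W)` for `(A, p, c)`, `p ≠ 0`, and a CM abelian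
variety `B` with a rational `(p,p)`-class `b`: `(fst ≫ f, n + dim B, s, fst^* W + snd^* b)` is a CM-anchored datum for
`(A, p, c)` (anchor `A₁ × B`, homomorphism `(g, 0)`; the `0`-component kills `b` in degree `2p ≠ 0`), and at EVERY fibre
algebraicity of the restricted class forces `b` algebraic (slice `(0, 𝟙) : B ⟶ 𝒳_t × B` and
`map_mem_algebraicClasses_of_abelianVariety`). [folklore] -/
theorem IsCMAnchoredDatumFor.prod {A : AbelianVariety ℂ} {p : ℕ} (hp : p ≠ 0) {c : complexBetti A.X (2 * p)}
    {f : 𝒳 ⟶ S} {n : ℕ} {s : ComplexPoints S} {W : complexBetti 𝒳 (2 * p)} (hd : IsCMAnchoredDatumFor A p c f n s W)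
    (B : AbelianVariety ℂ) (hB : IsOfCMType B) {b : complexBetti B.X (2 * p)} (hbQ : IsRationalClass b)
    (hbH : IsOfHodgeType B.dim B.X (2 * p) p p b) :
    IsCMAnchoredDatumFor A p c (fst 𝒳 B.X ≫ f) (n + B.dim) s
        (complexBetti.map (fst 𝒳 B.X) (2 * p) W + complexBetti.map (snd 𝒳 B.X) (2 * p) b) ∧
      ∀ t : ComplexPoints S,
        complexBetti.map (fiberι (fst 𝒳 B.X ≫ f) t) (2 * p)
            (complexBetti.map (fst 𝒳 B.X) (2 * p) W + complexBetti.map (snd 𝒳 B.X) (2 * p) b) ∈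
          algebraicClasses (fiberOver (fst 𝒳 B.X ≫ f) t) p →
        b ∈ algebraicClasses B.X p := by
  obtain ⟨hfam, hW, A₁, e₁, g, q, hq, hgc⟩ := hd
  have hf : IsSmoothProjectiveFamily f n := hfam.1
  have hab : ∀ t : ComplexPoints S, ∃ A' : AbelianVariety ℂ, A'.dim = n ∧ Nonempty (A'.X ≅ fiberOver f t) :=
    hfam.2.2.2.2.2.1
  have hBsp : IsSmoothProjective B.dim B.X := AbelianVariety.isSmoothProjective_holds
  have h2p : 2 * p ≠ 0 := by omega
  refine ⟨⟨isCMPointedAbelianFamily_fst_comp hfam B hB, fun t ↦ ?_, ?_⟩, fun t halg ↦ ?_⟩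
  · -- fibrewise rational of type `(p,p)`: `(𝒳 ⊗ B)_t ≅ 𝒳_t ⊗ B` and the class restricts to `fst^*(W|_t) + snd^* b`
    obtain ⟨e, he⟩ := exists_fiberOver_fst_comp_iso f B.X t
    have hXt : IsSmoothProjective n (fiberOver f t) := hf.isSmoothProjective t
    have hXB : IsSmoothProjective (n + B.dim) (fiberOver f t ⊗ B.X) := IsSmoothProjective.tensor_holds hXt hBsp
    have hcomp : complexBetti.map e.hom (2 * p) (complexBetti.map (fiberι (fst 𝒳 B.X ≫ f) t) (2 * p)
        (complexBetti.map (fst 𝒳 B.X) (2 * p) W + complexBetti.map (snd 𝒳 B.X) (2 * p) b)) =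
        complexBetti.map (fst (fiberOver f t) B.X) (2 * p) (complexBetti.map (fiberι f t) (2 * p) W) +
          complexBetti.map (snd (fiberOver f t) B.X) (2 * p) b := by
      rw [← complexBetti.map_comp_apply', he, complexBetti_map_whiskerRight_fst_add_snd]
    refine ⟨(isRationalClass_map_iff_of_iso e).1 ?_, (isOfHodgeType_map_iff_of_iso e).1 ?_⟩
    · rw [hcomp]
      exact ((hW t).1.map _).add (hbQ.map _)
    · rw [hcomp]
      exact ((hW t).2.map_of_isSmoothProjective hXB hXt (fst _ _)).add hXB
        (hbH.map_of_isSmoothProjective hXB hBsp (snd _ _))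
  · -- the anchor: `A₁ × B`, chart `e₁ ▷ B ≫ e`, homomorphism `(g, 0)`
    obtain ⟨ι, hι⟩ := exists_tensor_iso_fiberOver_fst_comp f B.X s e₁
    obtain ⟨u, ⟨G, hGu⟩, hu₁, hu₂⟩ := exists_prodLift_schemeHom g (0 : A ⟶ B)
    refine ⟨A₁.prod B, ι, G, q, hq, ?_⟩
    have key : complexBetti.map u (2 * p) (complexBetti.map ι.hom (2 * p)
        (complexBetti.map (fiberι (fst 𝒳 B.X ≫ f) s) (2 * p)
          (complexBetti.map (fst 𝒳 B.X) (2 * p) W + complexBetti.map (snd 𝒳 B.X) (2 * p) b))) = (q : ℂ) • c := by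
      rw [← complexBetti.map_comp_apply' ι.hom, hι, complexBetti_map_whiskerRight_fst_add_snd, map_add,
        ← complexBetti.map_comp_apply' u (fst A₁.X B.X), ← complexBetti.map_comp_apply' u (snd A₁.X B.X), hu₁, hu₂,
        complexBetti_map_zero_hom_apply h2p, add_zero, complexBetti.map_comp_apply']
      exact hgc
    rw [hGu]
    exact key
  · -- failure transport at the fibre `t`: slice `(0, 𝟙) : B ⟶ A' × B ≅ (𝒳 ⊗ B)_t`
    obtain ⟨A', -, ⟨eA⟩⟩ := hab t
    obtain ⟨ι, hι⟩ := exists_tensor_iso_fiberOver_fst_comp f B.X t eA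
    obtain ⟨w, -, hw₁, hw₂⟩ := exists_prodLift_schemeHom (0 : B ⟶ A') (𝟙 B)
    have h₁ : complexBetti.map ι.hom (2 * p) (complexBetti.map (fiberι (fst 𝒳 B.X ≫ f) t) (2 * p)
        (complexBetti.map (fst 𝒳 B.X) (2 * p) W + complexBetti.map (snd 𝒳 B.X) (2 * p) b)) ∈
          algebraicClasses (A'.X ⊗ B.X) p :=
      (mem_algebraicClasses_map_iff_of_iso ι).2 halg
    have h₂ : complexBetti.map w (2 * p) (complexBetti.map ι.hom (2 * p)
        (complexBetti.map (fiberι (fst 𝒳 B.X ≫ f) t) (2 * p)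
          (complexBetti.map (fst 𝒳 B.X) (2 * p) W + complexBetti.map (snd 𝒳 B.X) (2 * p) b))) ∈
          algebraicClasses B.X p :=
      map_mem_algebraicClasses_of_abelianVariety hBsp (A'.prod B) w h₁
    rw [← complexBetti.map_comp_apply' ι.hom, hι, complexBetti_map_whiskerRight_fst_add_snd, map_add,
      ← complexBetti.map_comp_apply' w (fst A'.X B.X), ← complexBetti.map_comp_apply' w (snd A'.X B.X), hw₁, hw₂,
      complexBetti_map_zero_hom_apply h2p, zero_add] at h₂
    have hid : complexBetti.map (𝟙 B : B ⟶ B).hom.hom.hom (2 * p) b = b := abelianVariety_map_id_apply b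
    rwa [hid] at h₂

/-! ## §4 Mod Deligne's printed fact: the converses, hence the EXACT codimension-graded location of `F_CM` and `F_CM^mid` -/

/-- **Anchored CM failures exist for EVERY rational `(p,p)`-class `c` on every `A` as soon as `HC_CM` fails in codimension
`p ≠ 0`**, MOD `hF` (displayed): Deligne's Mumford–Tate family through `A` (part VII `exists_datum_of_isCMDenseMumfordTateFamilyFor`)
times the CM witness `B` is, by the fact-free engine §3, a CM-anchored datum for `(A, p, c)` whose class fails at every
(CM) fibre. Whether `c` itself is algebraic plays no role. [cite: Deligne1982HodgeCycles, Prop. 6.1 (a)(b) (p. 71)] -/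
theorem exists_isCMAnchoredDatumFor_and_cmFailure_of_deligne1982 (hF : deligne1982_cmDenseMumfordTateFamilies)
    {A : AbelianVariety ℂ} (hA : IsSmoothProjective A.dim A.X) {p : ℕ} (hp : p ≠ 0) {c : complexBetti A.X (2 * p)}
    (hc : IsRationalClass c) (hpp : IsOfHodgeType A.dim A.X (2 * p) p p c) {B : AbelianVariety ℂ} (hB : IsOfCMType B)
    {b : complexBetti B.X (2 * p)} (hbQ : IsRationalClass b) (hbH : IsOfHodgeType B.dim B.X (2 * p) p p b)
    (hnb : b ∉ algebraicClasses B.X p) :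
    ∃ (n : ℕ) (𝒳 S : SchemeOver ℂ) (f : 𝒳 ⟶ S) (s : ComplexPoints S) (W : complexBetti 𝒳 (2 * p)),
      IsCMAnchoredDatumFor A p c f n s W ∧
        ∃ s' ∈ cmLocus f n, complexBetti.map (fiberι f s') (2 * p) W ∉ algebraicClasses (fiberOver f s') p := by
  obtain ⟨𝒳, S, f, hfam⟩ := hF A hA p c hc hpp
  obtain ⟨s, W, hd, -⟩ := exists_datum_of_isCMDenseMumfordTateFamilyFor hfam
  obtain ⟨-, -, -, -, -, -, t, ht⟩ := hd.1
  obtain ⟨hd', hfail⟩ := hd.prod hp B hB hbQ hbH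
  exact ⟨_, _, _, _, s, _, hd', t, cmLocus_subset_cmLocus_fst_comp f B hB ht, fun halg ↦ hnb (hfail t halg)⟩

/-- **POINTWISE READING of `F_CM`, mod `hF`**, for a rational `(p,p)`-class `c` on `A`, `p ≠ 0`: the instance of `F_CM` at
`(A, p, c)` holds iff (`c` is a Hodge failure ⟹ `HC_CM` fails in codimension `p`). The forward direction is fact-free
(`not_codim_cm_of_isCMAnchoredDatumFor_of_not_mem`). [cite: Deligne1982HodgeCycles, Prop. 6.1 (a)(b) (p. 71)] -/
theorem hodgeFailureSpreadsToCMFibreAt_iff_of_deligne1982 (hF : deligne1982_cmDenseMumfordTateFamilies)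
    {A : AbelianVariety ℂ} (hA : IsSmoothProjective A.dim A.X) {p : ℕ} (hp : p ≠ 0) {c : complexBetti A.X (2 * p)}
    (hc : IsRationalClass c) (hpp : IsOfHodgeType A.dim A.X (2 * p) p p c) :
    (c ∉ algebraicClasses A.X p →
        ∃ (n : ℕ) (𝒳 S : SchemeOver ℂ) (f : 𝒳 ⟶ S) (s : ComplexPoints S) (W : complexBetti 𝒳 (2 * p)),
          IsCMAnchoredDatumFor A p c f n s W ∧
            ∃ s' ∈ cmLocus f n, complexBetti.map (fiberι f s') (2 * p) W ∉ algebraicClasses (fiberOver f s') p) ↔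
      (c ∉ algebraicClasses A.X p → ¬ HC_CM⁽p⁾) := by
  refine ⟨fun h hnc hCMp ↦ ?_, fun h hnc ↦ ?_⟩
  · obtain ⟨n, 𝒳, S, f, s, W, hd, s', hs', hns'⟩ := h hnc
    exact not_codim_cm_of_isCMAnchoredDatumFor_of_not_mem hd hs' hns' hCMp
  · have hCMp := h hnc
    push Not at hCMp
    obtain ⟨B, hB, b, hbQ, hbH, hnb⟩ := hCMp
    exact exists_isCMAnchoredDatumFor_and_cmFailure_of_deligne1982 hF hA hp hc hpp hB hbQ hbH hnb

/-- **`(∀ p, HC_CM⁽p⁾ → HC_AV⁽p⁾) ⟹ F_CM`** MOD `hF` (displayed): a Hodge failure `(A, p, c)` forces `p ≠ 0`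
(`algebraicClasses_zero`) and, by the hypothesis in codimension `p`, a CM failure of codimension `p`; conclude by
`exists_isCMAnchoredDatumFor_and_cmFailure_of_deligne1982`. [cite: Deligne1982HodgeCycles, Prop. 6.1 (a)(b) (p. 71)] -/
theorem hodgeFailureSpreadsToCMFibre_of_forall_codim_cmToAbelian_of_deligne1982
    (hF : deligne1982_cmDenseMumfordTateFamilies) (h : ∀ p : ℕ, HC_CM⁽p⁾ → HC_AV⁽p⁾) :
    HodgeFailureSpreadsToCMFibre := by
  intro A hA p c hc hpp hnc
  rcases Nat.eq_zero_or_pos p with rfl | hp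
  · exact absurd (by rw [algebraicClasses_zero]; exact Submodule.mem_top) hnc
  have hCMp : ¬ HC_CM⁽p⁾ := fun hCMp ↦ hnc (h p hCMp A c hc hpp)
  push Not at hCMp
  obtain ⟨B, hB, b, hbQ, hbH, hnb⟩ := hCMp
  exact exists_isCMAnchoredDatumFor_and_cmFailure_of_deligne1982 hF hA hp.ne' hc hpp hB hbQ hbH hnb

/-- **EXACT LOCATION OF THE FLOOR CLASS, mod `hF`: `F_CM ⟺ ∀ p, (HC_CM⁽p⁾ → HC_AV⁽p⁾)`.**
[cite: Deligne1982HodgeCycles, Prop. 6.1 (a)(b) (p. 71)] -/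
theorem hodgeFailureSpreadsToCMFibre_iff_forall_codim_cmToAbelian_of_deligne1982
    (hF : deligne1982_cmDenseMumfordTateFamilies) :
    HodgeFailureSpreadsToCMFibre ↔ ∀ p : ℕ, HC_CM⁽p⁾ → HC_AV⁽p⁾ :=
  ⟨forall_codim_cmToAbelian_of_hodgeFailureSpreadsToCMFibre,
    hodgeFailureSpreadsToCMFibre_of_forall_codim_cmToAbelian_of_deligne1982 hF⟩

/-- **`(∀ m ≥ 2, HC_CM⁽m⁾ → HC_AVmid⁽m⁾) ⟹ F_CM^mid`** MOD `hF` (displayed), binder for binder as for `F_CM`.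
[cite: Deligne1982HodgeCycles, Prop. 6.1 (a)(b) (p. 71)] -/
theorem middleHodgeFailureSpreadsToCMFibre_of_forall_codim_middle_of_deligne1982
    (hF : deligne1982_cmDenseMumfordTateFamilies) (h : ∀ m : ℕ, 2 ≤ m → HC_CM⁽m⁾ → HC_AVmid⁽m⁾) :
    MiddleHodgeFailureSpreadsToCMFibre := by
  intro A hA m hm hdim c hc hpp hnc
  have hCMm : ¬ HC_CM⁽m⁾ := fun hCMm ↦ hnc (h m hm hCMm A hdim c hc hpp)
  push Not at hCMm
  obtain ⟨B, hB, b, hbQ, hbH, hnb⟩ := hCMm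
  exact exists_isCMAnchoredDatumFor_and_cmFailure_of_deligne1982 hF hA (by omega) hc hpp hB hbQ hbH hnb

/-- **EXACT LOCATION OF `F_CM^mid`, mod `hF`: `F_CM^mid ⟺ ∀ m ≥ 2, (HC_CM⁽m⁾ → HC_AVmid⁽m⁾)`.**
[cite: Deligne1982HodgeCycles, Prop. 6.1 (a)(b) (p. 71)] -/
theorem middleHodgeFailureSpreadsToCMFibre_iff_forall_codim_middle_of_deligne1982
    (hF : deligne1982_cmDenseMumfordTateFamilies) :
    MiddleHodgeFailureSpreadsToCMFibre ↔ ∀ m : ℕ, 2 ≤ m → HC_CM⁽m⁾ → HC_AVmid⁽m⁾ :=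
  ⟨forall_codim_middle_of_middleHodgeFailureSpreadsToCMFibre,
    middleHodgeFailureSpreadsToCMFibre_of_forall_codim_middle_of_deligne1982 hF⟩

/-! ## §5 The assembled reading -/

/-- The served item is the UNGRADED implication: `CMToAbelian ↔ ((∀ p, HC_CM⁽p⁾) → ∀ p, HC_AV⁽p⁾)`, NO fact. [folklore] -/
theorem cmToAbelian_iff_forall_codim_imp : CMToAbelian ↔ ((∀ p : ℕ, HC_CM⁽p⁾) → ∀ p : ℕ, HC_AV⁽p⁾) := by
  refine ⟨fun h hCM ↦ HC_AV_iff_forall_codim.1 (iff_hodgeConjecture_restricted.2 (h (HC_CM_iff_forall_codim.2 hCM))),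
    fun h hCM A _ ↦ ?_⟩
  exact (HC_AV_iff_forall_codim.2 (h (HC_CM_iff_forall_codim.1 hCM))) A

/-- **The codimension reading of the spreading floor (parts VII, XV, XXIII, XXIV located), MOD `hF`** (displayed):
`F_CM ⟺ ∀ p (HC_CM⁽p⁾ → HC_AV⁽p⁾)`, `F_CM^mid ⟺ ∀ m ≥ 2 (HC_CM⁽m⁾ → HC_AVmid⁽m⁾)`; and, fact-free, the graded implication gives
the served item, which is the ungraded one. Whether graded and ungraded differ is NOT asserted.
[cite: Deligne1982HodgeCycles, Prop. 6.1 (a)(b) (p. 71)] -/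
theorem spreadFloor_codimension_reading_of_deligne1982 (hF : deligne1982_cmDenseMumfordTateFamilies) :
    (HodgeFailureSpreadsToCMFibre ↔ ∀ p : ℕ, HC_CM⁽p⁾ → HC_AV⁽p⁾) ∧
      (MiddleHodgeFailureSpreadsToCMFibre ↔ ∀ m : ℕ, 2 ≤ m → HC_CM⁽m⁾ → HC_AVmid⁽m⁾) ∧
      ((∀ p : ℕ, HC_CM⁽p⁾ → HC_AV⁽p⁾) → CMToAbelian) ∧
      (CMToAbelian ↔ ((∀ p : ℕ, HC_CM⁽p⁾) → ∀ p : ℕ, HC_AV⁽p⁾)) :=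
  ⟨hodgeFailureSpreadsToCMFibre_iff_forall_codim_cmToAbelian_of_deligne1982 hF,
    middleHodgeFailureSpreadsToCMFibre_iff_forall_codim_middle_of_deligne1982 hF,
    cmToAbelian_of_forall_codim_cmToAbelian, cmToAbelian_iff_forall_codim_imp⟩

end Summit.HodgeConjecture.HodgeConjecture.Ring2.AbelianAll

end
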